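import Summits.QuantumFields.YangMills.Theorems.SwapVirialDeficitBlowUpGnomonicDefs
import HarnessLib

/-!
# The EULER DILATION of the gnomonic coordinates is LINEAR with Jacobian `t^(7+3|Fol L|) = t^(18L⁴−2)`: change of variables on `GnoCoord L`
# (file A1 of the V2′ assembly of fcl-p3 g45's virial SPEC, memo2-24197-window v2 §2′; free-hands support of ⟨stmt-QuantumFields-24197⟩
# `SwapVirialDeficit.SwapGluedStiffness`)

✓`BlowUpRing.blowUpPoint_gnomonicPoint` (G0) says the joint blow-up IS the mixed Euler dilation ✓`eulerDilate t` of the gnomonic coordinates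
`η ∈ GnoCoord L = ((ℝ³ × ℝ³) × ℝ³ × (Fol L → ℝ³))` — transverse (`diag(1,t,t)`) on the letters `x, y`, full (`t·`) on `z` and on every follower.  This file is the
measure-theoretic bookkeeping of that dilation, for the Euler-field integration by parts of the next file (A2, the `GnoCoord` twin of w2 g57's
✓`Gnomonic.integral_flowDeriv_mul_piWeight`):
* §1 `trDil_eq_toLin'`, ★ `exists_linearMap_eulerDilate` — `eulerDilate t` is (the coercion of) a linear map of determinant `t^(7+3·|Fol L|)`
  (`LinearMap.det_prodMap`, `det_toLin'`, `det_diagonal`, `det_smul`); `continuous_eulerDilate`, `measurable_eulerDilate`, the inverse `eulerDilate t⁻¹`;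
* §2 the product space `GnoCoord L`: `borelSpace_gnoCoord`, `isAddHaarMeasure_volume_gnoCoord` (TECH: typeclass synthesis on the 4-fold product needs
  `synthInstance.maxSize 1024`, and the Haar instance is only found on the unfolded `((vol ⊗ vol) ⊗ (vol ⊗ vol))` — recorded here once for the consumers);
  ★ `map_eulerDilate_volume` (`map (eulerDilate t) vol = |t^{−(7+3|Fol L|)}| • vol`, ✓`Measure.map_linearMap_addHaar_eq_smul_addHaar`),
  ★★ `integral_comp_eulerDilate` (`∫ k(eulerDilate t η) dη = t^{−(7+3|Fol L|)}·∫ k`, any `k`, `t > 0`), ★★ `integral_eulerDilate_gnoDensity` — the DILATION IDENTITY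
  WITH THE GNOMONIC DENSITY `∫ g(eulerDilate eˢ η)·ρ(η) dη = e^{−(7+3|Fol L|)s}·∫ g(η)·ρ(eulerDilate e^{−s} η) dη`;
* §3 the density ✓`gnoDensity` and the Euler weight ✓`gnoW` (G0 §4): `gnoDensity_pos/_le_one`, `continuous_gnoDensity`, ★ `integrable_gnoDensity`
  (`Integrable.mul_prod` ×3), `gnoDensity_eulerDilate`, `normSq3_trDil`, `gnomonicWeight_trDil`, `gnoWtr_trDil`, `continuous_gnoWtr`, `continuous_gnomonicW`,
  `continuous_gnoW`; and the exponent `7 + 3·|Fol L| = 18L⁴ − 2 = 2α` (`two_alpha_eq`).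
HONEST LABEL: linear algebra ∕ change of variables only; nothing about ⟨24197⟩ or any rung is proved; the Yang–Mills mass gap is NOT proved; no summit is
proved by a line.  Seat ym-line-fcl-p3 g46 (cell ym-idea-1, free hands; item of record ⟨24085⟩ aside, untouched), `--supports stmt-QuantumFields-24197`.
THEOREMS ONLY, 0 `sorry`, standard axioms.  References: [folklore] (Jacobian of a linear map; Euler's dilation).
-/

set_option autoImplicit false
set_option synthInstance.maxSize 1024

noncomputable section

open MeasureTheory Set Filter Topology Module
open scoped BigOperators ENNReal

namespace Summit.QuantumFields.YangMills.Theorems.SwapVirialDeficit.BlowUpRing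

open Summit.QuantumFields.YangMills.Theorems.SwapVirialDeficit.Gnomonic (normSq3 gnomonicWeight gnomonicW piWeight normSq3_nonneg
  gnomonicWeight_pos gnomonicWeight_le_one piWeight_pos piWeight_le_one continuous_gnomonicWeight continuous_piWeight integrable_gnomonicWeight
  integrable_piWeight finrank_pi3 gnomonicW_nonneg_le)

variable {L : ℕ} [NeZero L]

/-! ## §1 The Euler dilation is a linear map of determinant `t^(7+3|Fol L|)` -/

/-- The transverse dilation is `diag(1, t, t)`: `trDil t v = toLin' (diagonal (1, t, t)) v`. [folklore] -/
theorem trDil_eq_toLin' (t : ℝ) (v : Fin 3 → ℝ) : trDil t v = Matrix.toLin' (Matrix.diagonal ![1, t, t]) v := by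
  rw [Matrix.toLin'_apply]
  ext i
  rw [Matrix.mulVec_diagonal]
  fin_cases i <;> simp [trDil]

/-- `det diag(1, t, t) = t²`. [folklore] -/
theorem det_toLin'_trDil (t : ℝ) : LinearMap.det (Matrix.toLin' (Matrix.diagonal ![(1 : ℝ), t, t])) = t ^ 2 := by
  rw [LinearMap.det_toLin', Matrix.det_diagonal, Fin.prod_univ_three]
  simp; ring

/-- ★ **`eulerDilate t` IS LINEAR, OF DETERMINANT `t^(7+3·|Fol L|)`**: it is the coercion of the block-diagonal linear map
`diag(1,t,t) × diag(1,t,t) × (t·id_{ℝ³}) × (t·id_{(ℝ³)^{Fol L}})`. [folklore] -/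
theorem exists_linearMap_eulerDilate (t : ℝ) :
    ∃ T : GnoCoord L →ₗ[ℝ] GnoCoord L, (∀ η, T η = eulerDilate t η) ∧ LinearMap.det T = t ^ (7 + 3 * Fintype.card (Fol L)) := by
  refine ⟨((Matrix.toLin' (Matrix.diagonal ![(1 : ℝ), t, t])).prodMap (Matrix.toLin' (Matrix.diagonal ![(1 : ℝ), t, t]))).prodMap
      ((t • (LinearMap.id : (Fin 3 → ℝ) →ₗ[ℝ] (Fin 3 → ℝ))).prodMap (t • (LinearMap.id : (Fol L → Fin 3 → ℝ) →ₗ[ℝ] (Fol L → Fin 3 → ℝ)))),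
    fun η => ?_, ?_⟩
  · simp only [LinearMap.prodMap_apply, LinearMap.smul_apply, LinearMap.id_apply, ← trDil_eq_toLin', eulerDilate]
    rfl
  · rw [LinearMap.det_prodMap, LinearMap.det_prodMap, LinearMap.det_prodMap, det_toLin'_trDil, LinearMap.det_smul, LinearMap.det_smul,
      LinearMap.det_id, LinearMap.det_id, Module.finrank_fin_fun, finrank_pi3]
    ring

/-- `eulerDilate t` is continuous. [folklore] -/
theorem continuous_eulerDilate (t : ℝ) : Continuous (eulerDilate (L := L) t) := by
  obtain ⟨T, hT, -⟩ := exists_linearMap_eulerDilate (L := L) t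
  have h : eulerDilate (L := L) t = ⇑T := funext fun η => (hT η).symm
  rw [h]
  exact T.continuous_of_finiteDimensional

/-! ## §2 The product space `GnoCoord L`: Borel structure, Haar, and the change of variables -/

/-- `GnoCoord L` is a Borel space (recorded: the synthesized instance has size `180 > 128`, hence `synthInstance.maxSize 1024` above). [folklore] -/
theorem borelSpace_gnoCoord : BorelSpace (GnoCoord L) := inferInstance

/-- Lebesgue measure on `GnoCoord L` is an additive Haar measure (found by typeclass synthesis only on the unfolded product `(vol ⊗ vol) ⊗ (vol ⊗ vol^{Fol})`).
[folklore] -/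
theorem isAddHaarMeasure_volume_gnoCoord : (volume : Measure (GnoCoord L)).IsAddHaarMeasure := by
  show (((volume : Measure (Fin 3 → ℝ)).prod (volume : Measure (Fin 3 → ℝ))).prod
    ((volume : Measure (Fin 3 → ℝ)).prod (volume : Measure (Fol L → Fin 3 → ℝ)))).IsAddHaarMeasure
  infer_instance

/-- `eulerDilate t` is measurable. [folklore] -/
theorem measurable_eulerDilate (t : ℝ) : Measurable (eulerDilate (L := L) t) :=
  (continuous_eulerDilate t).measurable

omit [NeZero L] in
/-- `eulerDilate t⁻¹ (eulerDilate t η) = η` for `t ≠ 0`. [folklore] -/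
theorem eulerDilate_inv_apply {t : ℝ} (ht : t ≠ 0) (η : GnoCoord L) : eulerDilate t⁻¹ (eulerDilate t η) = η := by
  rw [eulerDilate_eulerDilate, inv_mul_cancel₀ ht, eulerDilate_one]

omit [NeZero L] in
/-- `eulerDilate t (eulerDilate t⁻¹ η) = η` for `t ≠ 0`. [folklore] -/
theorem eulerDilate_apply_inv {t : ℝ} (ht : t ≠ 0) (η : GnoCoord L) : eulerDilate t (eulerDilate t⁻¹ η) = η := by
  rw [eulerDilate_eulerDilate, mul_inv_cancel₀ ht, eulerDilate_one]

/-- ★ **The image of Lebesgue measure under the Euler dilation**: `map (eulerDilate t) vol = |t^{−(7+3|Fol L|)}| • vol` (`t ≠ 0`). [folklore] -/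
theorem map_eulerDilate_volume {t : ℝ} (ht : t ≠ 0) :
    Measure.map (eulerDilate (L := L) t) volume = ENNReal.ofReal |(t ^ (7 + 3 * Fintype.card (Fol L)))⁻¹| • volume := by
  haveI : (volume : Measure (GnoCoord L)).IsAddHaarMeasure := isAddHaarMeasure_volume_gnoCoord
  obtain ⟨T, hT, hdet⟩ := exists_linearMap_eulerDilate (L := L) t
  have hfun : eulerDilate (L := L) t = ⇑T := funext fun η => (hT η).symm
  have hdet0 : LinearMap.det T ≠ 0 := by rw [hdet]; exact pow_ne_zero _ ht
  rw [hfun, Measure.map_linearMap_addHaar_eq_smul_addHaar volume hdet0, hdet]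

/-- ★★ **CHANGE OF VARIABLES UNDER THE EULER DILATION**: `∫ k(eulerDilate t η) dη = t^{−(7+3|Fol L|)} · ∫ k(η) dη` for every `k` and `t > 0`
(no measurability needed: `eulerDilate t` is a measurable equivalence). [folklore] -/
theorem integral_comp_eulerDilate (k : GnoCoord L → ℝ) {t : ℝ} (ht : 0 < t) :
    ∫ η, k (eulerDilate t η) = (t ^ (7 + 3 * Fintype.card (Fol L)))⁻¹ * ∫ η, k η := by
  let e : GnoCoord L ≃ᵐ GnoCoord L :=
    { toFun := eulerDilate t
      invFun := eulerDilate t⁻¹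
      left_inv := fun η => eulerDilate_inv_apply ht.ne' η
      right_inv := fun η => eulerDilate_apply_inv ht.ne' η
      measurable_toFun := measurable_eulerDilate t
      measurable_invFun := measurable_eulerDilate t⁻¹ }
  have he : (⇑e : GnoCoord L → GnoCoord L) = eulerDilate t := rfl
  have h1 : ∫ η, k (eulerDilate t η) = ∫ y, k y ∂(Measure.map e volume) := by
    rw [integral_map_equiv]; rfl
  rw [h1, he, map_eulerDilate_volume ht.ne', integral_smul_measure, ENNReal.toReal_ofReal (abs_nonneg _),
    abs_of_pos (inv_pos.2 (pow_pos ht _)), smul_eq_mul]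

/-- The exponent as a real number: `((7 + 3·|Fol L| : ℕ) : ℝ) = 7 + 3·|Fol L|`. [folklore] -/
theorem cast_seven_add : ((7 + 3 * Fintype.card (Fol L) : ℕ) : ℝ) = 7 + 3 * (Fintype.card (Fol L) : ℝ) := by push_cast; ring

omit [NeZero L] in
/-- `e^{−s} · e^{s}`-bookkeeping: `eulerDilate (e^{−s}) (eulerDilate (e^{s}) η) = η`. [folklore] -/
theorem eulerDilate_exp_neg_exp (s : ℝ) (η : GnoCoord L) : eulerDilate (Real.exp (-s)) (eulerDilate (Real.exp s) η) = η := by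
  rw [eulerDilate_eulerDilate, ← Real.exp_add, neg_add_cancel, Real.exp_zero, eulerDilate_one]

/-- ★★ **THE DILATION IDENTITY WITH THE GNOMONIC DENSITY**:
`∫ g(eulerDilate eˢ η)·ρ(η) dη = e^{−(7+3|Fol L|)s} · ∫ g(η)·ρ(eulerDilate e^{−s} η) dη` (`ρ = gnoDensity`; any `g`). [folklore] -/
theorem integral_eulerDilate_gnoDensity (g : GnoCoord L → ℝ) (s : ℝ) :
    ∫ η, g (eulerDilate (Real.exp s) η) * gnoDensity η =
      Real.exp (-((7 + 3 * (Fintype.card (Fol L) : ℝ)) * s)) * ∫ η, g η * gnoDensity (eulerDilate (Real.exp (-s)) η) := by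
  have h := integral_comp_eulerDilate (L := L) (fun η => g η * gnoDensity (eulerDilate (Real.exp (-s)) η)) (Real.exp_pos s)
  have e : (fun η : GnoCoord L => g (eulerDilate (Real.exp s) η) * gnoDensity (eulerDilate (Real.exp (-s)) (eulerDilate (Real.exp s) η))) =
      fun η => g (eulerDilate (Real.exp s) η) * gnoDensity η := by
    funext η; rw [eulerDilate_exp_neg_exp]
  rw [e] at h
  rw [h, ← cast_seven_add, ← Real.exp_nat_mul, ← Real.exp_neg]

/-! ## §3 The density, the Euler weight, and the transverse letters -/

/-- `0 < gnoDensity`. [folklore] -/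
theorem gnoDensity_pos (η : GnoCoord L) : 0 < gnoDensity η := by
  unfold gnoDensity
  exact mul_pos (mul_pos (mul_pos (gnomonicWeight_pos _) (gnomonicWeight_pos _)) (gnomonicWeight_pos _)) (piWeight_pos _)

/-- `gnoDensity ≤ 1`. [folklore] -/
theorem gnoDensity_le_one (η : GnoCoord L) : gnoDensity η ≤ 1 := by
  unfold gnoDensity
  have h1 := gnomonicWeight_le_one η.1.1
  have h2 := gnomonicWeight_le_one η.1.2
  have h3 := gnomonicWeight_le_one η.2.1
  have h4 := piWeight_le_one η.2.2
  have p1 := (gnomonicWeight_pos η.1.1).le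
  have p2 := (gnomonicWeight_pos η.1.2).le
  have p3 := (gnomonicWeight_pos η.2.1).le
  have p4 := (piWeight_pos η.2.2).le
  calc gnomonicWeight η.1.1 * gnomonicWeight η.1.2 * gnomonicWeight η.2.1 * piWeight η.2.2 ≤ 1 * 1 * 1 * 1 := by gcongr
    _ = 1 := by norm_num

/-- `gnoDensity` is continuous. [folklore] -/
theorem continuous_gnoDensity : Continuous (gnoDensity (L := L)) := by
  unfold gnoDensity
  exact (((continuous_gnomonicWeight.comp (continuous_fst.comp continuous_fst)).mul
    (continuous_gnomonicWeight.comp (continuous_snd.comp continuous_fst))).mul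
      (continuous_gnomonicWeight.comp (continuous_fst.comp continuous_snd))).mul (continuous_piWeight.comp (continuous_snd.comp continuous_snd))

/-- `gnoDensity` is measurable. [folklore] -/
theorem measurable_gnoDensity : Measurable (gnoDensity (L := L)) := continuous_gnoDensity.measurable

/-- ★ **`gnoDensity` IS INTEGRABLE on `GnoCoord L`** (product of four integrable one-factor densities, ✓`Gnomonic.integrable_gnomonicWeight` ∕
✓`integrable_piWeight`, `Integrable.mul_prod`). [folklore] -/
theorem integrable_gnoDensity : Integrable (gnoDensity (L := L)) := by
  have h1 : Integrable (fun p : (Fin 3 → ℝ) × (Fin 3 → ℝ) => gnomonicWeight p.1 * gnomonicWeight p.2)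
      ((volume : Measure (Fin 3 → ℝ)).prod (volume : Measure (Fin 3 → ℝ))) :=
    integrable_gnomonicWeight.mul_prod integrable_gnomonicWeight
  have h2 : Integrable (fun p : (Fin 3 → ℝ) × (Fol L → Fin 3 → ℝ) => gnomonicWeight p.1 * piWeight p.2)
      ((volume : Measure (Fin 3 → ℝ)).prod (volume : Measure (Fol L → Fin 3 → ℝ))) :=
    integrable_gnomonicWeight.mul_prod integrable_piWeight
  have h := h1.mul_prod h2
  rw [show (volume : Measure (GnoCoord L)) = ((volume : Measure (Fin 3 → ℝ)).prod (volume : Measure (Fin 3 → ℝ))).prod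
    ((volume : Measure (Fin 3 → ℝ)).prod (volume : Measure (Fol L → Fin 3 → ℝ))) from rfl]
  refine h.congr (ae_of_all _ fun z => ?_)
  show gnomonicWeight z.1.1 * gnomonicWeight z.1.2 * (gnomonicWeight z.2.1 * piWeight z.2.2) = gnoDensity z
  unfold gnoDensity; ring

/-- The mass `∫ gnoDensity` is finite and positive-free bookkeeping: `∫ |gnoDensity| = ∫ gnoDensity`. [folklore] -/
theorem integral_gnoDensity_nonneg : 0 ≤ ∫ η : GnoCoord L, gnoDensity η := integral_nonneg fun η => (gnoDensity_pos η).le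

/-- The density at a dilated point, factorwise. [folklore] -/
theorem gnoDensity_eulerDilate (t : ℝ) (η : GnoCoord L) :
    gnoDensity (eulerDilate t η) = gnomonicWeight (trDil t η.1.1) * gnomonicWeight (trDil t η.1.2) * gnomonicWeight (t • η.2.1) * piWeight (t • η.2.2) := rfl

/-- The Euler weight at a dilated point, factorwise. [folklore] -/
theorem gnoW_eulerDilate (t : ℝ) (η : GnoCoord L) :
    gnoW (eulerDilate t η) = gnoWtr (trDil t η.1.1) + gnoWtr (trDil t η.1.2) + gnomonicW (t • η.2.1) + ∑ f, gnomonicW (t • η.2.2 f) := rfl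

/-- `|trDil t v|² = v₀² + t²(v₁² + v₂²)`. [folklore] -/
theorem normSq3_trDil (t : ℝ) (v : Fin 3 → ℝ) : normSq3 (trDil t v) = v 0 ^ 2 + t ^ 2 * (v 1 ^ 2 + v 2 ^ 2) := by
  unfold normSq3 trDil
  rw [Fin.sum_univ_three]
  simp; ring

/-- `Σ_i (trDil t v)_i² = v₀² + t²(v₁² + v₂²)` (the `∑` form used by ✓`gnoWtr`). [folklore] -/
theorem sum_sq_trDil (t : ℝ) (v : Fin 3 → ℝ) : ∑ i, trDil t v i ^ 2 = v 0 ^ 2 + t ^ 2 * (v 1 ^ 2 + v 2 ^ 2) := normSq3_trDil t v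

/-- The gnomonic weight of a transversely dilated letter: `w(trDil t v) = ((1 + v₀² + t²(v₁²+v₂²))⁻¹)²`. [folklore] -/
theorem gnomonicWeight_trDil (t : ℝ) (v : Fin 3 → ℝ) : gnomonicWeight (trDil t v) = ((1 + v 0 ^ 2 + t ^ 2 * (v 1 ^ 2 + v 2 ^ 2))⁻¹) ^ 2 := by
  unfold gnomonicWeight; rw [normSq3_trDil, add_assoc]

/-- The transverse Euler weight of a transversely dilated letter: `w_⊥(trDil t v) = 4t²(v₁²+v₂²)/(1 + v₀² + t²(v₁²+v₂²))`. [folklore] -/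
theorem gnoWtr_trDil (t : ℝ) (v : Fin 3 → ℝ) : gnoWtr (trDil t v) = 4 * (t ^ 2 * (v 1 ^ 2 + v 2 ^ 2)) / (1 + v 0 ^ 2 + t ^ 2 * (v 1 ^ 2 + v 2 ^ 2)) := by
  unfold gnoWtr
  rw [sum_sq_trDil, add_assoc]
  congr 1
  simp [trDil]; ring

/-- The gnomonic weight of a fully dilated letter: `w(t•v) = ((1 + t²|v|²)⁻¹)²`. [folklore] -/
theorem gnomonicWeight_smul (t : ℝ) (v : Fin 3 → ℝ) : gnomonicWeight (t • v) = ((1 + t ^ 2 * normSq3 v)⁻¹) ^ 2 := by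
  unfold gnomonicWeight; rw [Gnomonic.normSq3_smul]

/-- The Euler weight of a fully dilated letter: `W(t•v) = 4t²|v|²/(1 + t²|v|²)`. [folklore] -/
theorem gnomonicW_smul (t : ℝ) (v : Fin 3 → ℝ) : gnomonicW (t • v) = 4 * (t ^ 2 * normSq3 v) / (1 + t ^ 2 * normSq3 v) := by
  unfold gnomonicW; rw [Gnomonic.normSq3_smul]

/-- `w_⊥` is continuous. [folklore] -/
theorem continuous_gnoWtr : Continuous gnoWtr := by
  have hden : Continuous fun v : Fin 3 → ℝ => 1 + ∑ i, v i ^ 2 := by fun_prop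
  have hnum : Continuous fun v : Fin 3 → ℝ => 4 * (v 1 ^ 2 + v 2 ^ 2) := by fun_prop
  unfold gnoWtr
  refine hnum.div hden fun v => ?_
  have : 0 ≤ ∑ i, v i ^ 2 := Finset.sum_nonneg fun i _ => sq_nonneg (v i)
  exact ne_of_gt (by linarith)

/-- `W` is continuous. [folklore] -/
theorem continuous_gnomonicW : Continuous gnomonicW := by
  have h : Continuous normSq3 := by unfold normSq3; fun_prop
  unfold gnomonicW
  refine (continuous_const.mul h).div (continuous_const.add h) fun v => ?_
  have := normSq3_nonneg v
  exact ne_of_gt (by linarith)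

/-- The ring's Euler weight `gnoW` is continuous. [folklore] -/
theorem continuous_gnoW : Continuous (gnoW (L := L)) := by
  unfold gnoW
  refine ((((continuous_gnoWtr.comp (continuous_fst.comp continuous_fst)).add (continuous_gnoWtr.comp (continuous_snd.comp continuous_fst))).add
    (continuous_gnomonicW.comp (continuous_fst.comp continuous_snd))).add ?_)
  exact continuous_finsetSum _ fun f _ => continuous_gnomonicW.comp ((continuous_apply f).comp (continuous_snd.comp continuous_snd))

/-- `gnoW` is measurable. [folklore] -/
theorem measurable_gnoW : Measurable (gnoW (L := L)) := continuous_gnoW.measurable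

/-- `|gnoW η − (7 + 3|Fol L|)| ≤ 7 + 3|Fol L| + 4(3 + |Fol L|)` — a crude two-sided bound for the dominated-convergence steps of file A2. [folklore] -/
theorem abs_gnoW_sub_le (η : GnoCoord L) :
    |gnoW η - (7 + 3 * (Fintype.card (Fol L) : ℝ))| ≤ 7 + 3 * (Fintype.card (Fol L) : ℝ) + 4 * (3 + (Fintype.card (Fol L) : ℝ)) := by
  obtain ⟨h0, h1⟩ := gnoW_nonneg_le η
  have hc : (0 : ℝ) ≤ (Fintype.card (Fol L) : ℝ) := by positivity
  rw [abs_le]; constructor <;> linarith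

/-- The dilated dimension is `2α`: `7 + 3·|Fol L| = 18L⁴ − 2` (✓`card_fol`). [folklore] -/
theorem two_alpha_eq : 7 + 3 * Fintype.card (Fol L) = 18 * L ^ 4 - 2 := by
  rw [card_fol]
  have h1 : 1 ≤ L := Nat.one_le_iff_ne_zero.2 (NeZero.ne L)
  have h4 : 1 ≤ L ^ 4 := Nat.one_le_pow _ _ h1
  omega

end Summit.QuantumFields.YangMills.Theorems.SwapVirialDeficit.BlowUpRing

end
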